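import Summits.ResolutionOfSingularities.ResolutionOfSingularities.Theorems.FrobeniusClosingSteerJacobianLengthFrames
import Summits.ResolutionOfSingularities.ResolutionOfSingularities.Theorems.FrobeniusClosingSteerNestedCohenFramesSeparable
import Summits.ResolutionOfSingularities.ResolutionOfSingularities.Theorems.FrobeniusClosingSteerTwoBasisDecompositionB
import Summits.ResolutionOfSingularities.ResolutionOfSingularities.Theorems.FrobeniusClosingSteerRadicandCohenFrame
import Literature.NumberTheory.Transcendental.DerivationExtension
import Mathlib.RingTheory.Etale.Field
import HarnessLib

/-!
# Crux `Steer` (stmt-ResolutionOfSingularities-16345), chain W4.1, K3ᴳ: the ℓ-COMPARISON «LAST MILE» — `ℓ(Ŝ′ ⧸ 𝒥_abs f̂′) ≤ ℓ(Ŝ ⧸ 𝒥_abs f̂)` along an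
# UNRAMIFIED local homomorphism of regular local rings with finite separable residue extension (the étale-local enlargement of the K3ᴳ producer)

OURS (campaign `res-hironaka`, rung L ★L-G4, slot W4.1; seat res-L0-w41-stub-3 g8, res-L0-w41-plan-1 RULING 293 «stub-3 → the LAST MILE»; SPEC res-L0-w41-stub-2
`K3G/JacobianLengthEtale_signature.lean` 2002aab6dc189340 + PLAN v1.2 `K3G/JacobianLengthEtale-PLAN.md` a2de388f3c2d27db (SPEC v2: the finite-2-basis dual frame
of `κ(Ŝ)` is an INPUT); consumer = the K3ᴳ assembler `K3GTarget.horizonBaseChange` (res-D-lib-1), comparison clause of `GeomAssembly.geomChain_false_two_of_pieces`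
(p564413); replaces the role of no printed item; NOT a statement of the manuscript under review [claim: Hironaka2017, status: under-review]; AI-produced, weaker than
expert review). Theses-free, definition-free.

BINDER PACKAGING (the hand's choice per SPEC): the enlargement is given as a LOCAL ring hom `φ : S → S′` of regular local rings of characteristic `2` which is
UNRAMIFIED (`𝔪_S·S′ = 𝔪_{S′}`), EQUIDIMENSIONAL (`dim S′ = dim S`), with FINITE SEPARABLE residue extension `κ(S′)/κ(S)` (read through `κ(φ)`), plus a finite
2-basis dual frame `(γ, D)` of `κ(Ŝ)` — exactly the items of res-D-lib-1's K3 window interface (UNRAMIFIED / REGULARITY / `ringKrullDim S′ᵢ = ringKrullDim Sᵢ`)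
and of `GeomTwoBasis.exists_pFrame_completion_of_chart`; for the étale-local packaging of the SPEC (`A` finite étale over `S`, `S′ = A_𝔫`) these four
properties are the standard consequences (unramified + residually separable + flat of relative dimension 0).

PROOF = PLAN v1.2 (i)–(viii): the completed map `ψ : Ŝ → Ŝ′` (`Isol.exists_ringHom_adicCompletion_extend`), local; an r.s.o.p. `x` of `S` maps to an r.s.o.p. of
`S′` (unramified + equidimensional); `(σ, frame)` of `Ŝ` (`NestedFrames.exists_frame_with_section`); `κ(Ŝ′)/κ(Ŝ)` finite separable by transport along
`AdicCompletion.residueField_map_bijective`; STEP 1 `NestedFrames.exists_nested_frame_of_separable` (res-L0-w41-stub-2 p568373) gives the commuting frame of `Ŝ′`;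
`Module.finBasis`; `hgen` from `TwoBasis.pAdjoin_eq_top_of_isTwoBasis`; the dual derivations extend along the separable `κ(ψ)`
(`Derivation.exists_extension_of_formallySmooth`, formally étale); conclude by `JacobianLength.length_quotient_span_derivation_le_of_frames` (p568046).

* `JacobianLength.length_quotient_span_derivation_le_of_unramified` — the LAST MILE. [cite: Matsumura1987, Thm. 28.3, Thm. 30.6] [folklore]
-/

noncomputable section

set_option linter.dupNamespace false

open IsLocalRing MvPowerSeries
open Literature.RingTheory.Derivation Literature.FieldTheory.Separability Literature.AlgebraicGeometry.Resolution
open Summit.ResolutionOfSingularities.ResolutionOfSingularities.Theorems.SwitchingDichotomy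

namespace Summit.ResolutionOfSingularities.ResolutionOfSingularities.Theorems.SwitchingDichotomy.JacobianLength

/-- **Derivations extend along a separable field extension** (existence; `ℤ`-derivations, abstract fields so that the `Algebra ℤ` instances are the canonical
ones): formally étale ⇒ formally smooth ⇒ `Derivation.exists_extension_of_formallySmooth`. [cite: Matsumura1987, Thm. 25.3] [folklore] -/
theorem exists_derivation_extends_of_isSeparable {E L : Type} [Field E] [Field L] [Algebra E L] [Algebra.IsSeparable E L]
    (D : Derivation ℤ E E) : ∃ D' : Derivation ℤ L L, ∀ a : E, D' (algebraMap E L a) = algebraMap E L (D a) := by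
  haveI : Algebra.FormallyEtale E L := Algebra.FormallyEtale.of_isSeparable E L
  obtain ⟨D', hD'⟩ := Literature.NumberTheory.Transcendental.Derivation.exists_extension_of_formallySmooth (R := ℤ) (S := E) (T := L) (M := L)
    ((Algebra.linearMap E L).compDer D)
  exact ⟨D', fun a => by rw [hD' a]; rfl⟩

/-- **ℓ-comparison along an unramified, equidimensional, residually finite separable local homomorphism of regular local rings** (characteristic `2`,
finite 2-basis dual frame of `κ(Ŝ)` given): `ℓ_{Ŝ′}(Ŝ′ ⧸ (Dv (φ f)^)_{Dv}) ≤ ℓ_{Ŝ}(Ŝ ⧸ (Dv f̂)_{Dv})`. See the module docstring.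
[cite: Matsumura1987, Thm. 28.3, Thm. 30.6] [folklore] -/
theorem length_quotient_span_derivation_le_of_unramified
    {S S' : Type} [CommRing S] [CommRing S'] [IsRegularLocalRing S] [IsRegularLocalRing S'] [CharP S 2] [CharP S' 2]
    (φ : S →+* S') [IsLocalHom φ]
    (hunr : (maximalIdeal S).map φ = maximalIdeal S') (hdim : ringKrullDim S' = ringKrullDim S)
    (hfin : @Module.Finite (ResidueField S) (ResidueField S') _ _ (ResidueField.map φ).toAlgebra.toModule)
    (hsep : @Algebra.IsSeparable (ResidueField S) (ResidueField S') _ _ (ResidueField.map φ).toAlgebra)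
    (hfr : ∃ (r : ℕ) (γ : Fin r → ResidueField (AdicCompletion (maximalIdeal S) S))
      (D : Fin r → Derivation ℤ (ResidueField (AdicCompletion (maximalIdeal S) S)) (ResidueField (AdicCompletion (maximalIdeal S) S))),
      TwoBasis.IsTwoBasis γ ∧ ∀ l l', D l (γ l') = if l' = l then 1 else 0)
    (f : S) :
    Module.length (AdicCompletion (maximalIdeal S') S') (AdicCompletion (maximalIdeal S') S' ⧸
        Ideal.span (Set.range fun Dv : Derivation ℤ (AdicCompletion (maximalIdeal S') S') (AdicCompletion (maximalIdeal S') S') =>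
          Dv (algebraMap S' (AdicCompletion (maximalIdeal S') S') (φ f)))) ≤
      Module.length (AdicCompletion (maximalIdeal S) S) (AdicCompletion (maximalIdeal S) S ⧸
        Ideal.span (Set.range fun Dv : Derivation ℤ (AdicCompletion (maximalIdeal S) S) (AdicCompletion (maximalIdeal S) S) =>
          Dv (algebraMap S (AdicCompletion (maximalIdeal S) S) f))) := by
  classical
  haveI : Fact (Nat.Prime 2) := ⟨Nat.prime_two⟩
  -- ### instances on the completions
  haveI : IsNoetherianRing (AdicCompletion (maximalIdeal S) S) := isNoetherianRing_adicCompletion_maximalIdeal S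
  haveI : IsRegularLocalRing (AdicCompletion (maximalIdeal S) S) := isRegularLocalRing_adicCompletion S
  haveI : IsNoetherianRing (AdicCompletion (maximalIdeal S') S') := isNoetherianRing_adicCompletion_maximalIdeal S'
  haveI : IsRegularLocalRing (AdicCompletion (maximalIdeal S') S') := isRegularLocalRing_adicCompletion S'
  haveI : CharP (AdicCompletion (maximalIdeal S) S) 2 := RadicandCohenFrame.charP_adicCompletion 2 S
  haveI : CharP (ResidueField (AdicCompletion (maximalIdeal S) S)) 2 := RadicandCohenFrame.charP_residueField 2
  haveI : CharP (AdicCompletion (maximalIdeal S') S') 2 := RadicandCohenFrame.charP_adicCompletion 2 S'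
  haveI : CharP (ResidueField (AdicCompletion (maximalIdeal S') S')) 2 := RadicandCohenFrame.charP_residueField 2
  -- ### an r.s.o.p. of `S` and its image, an r.s.o.p. of `S′`
  obtain ⟨x, hx⟩ := exists_regularSystemOfParameters (R := S)
  have hS : ringKrullDim S = ((maximalIdeal S).spanFinrank : ℕ) := (IsRegularLocalRing.spanFinrank_maximalIdeal (R := S)).symm
  have hS' : ringKrullDim S' = ((maximalIdeal S).spanFinrank : ℕ) := hdim.trans hS
  have hy : Ideal.span (Set.range (φ ∘ x)) = maximalIdeal S' := by
    rw [Set.range_comp, ← Ideal.map_span, hx, hunr]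
  -- ### a coefficient field and a frame of `Ŝ`
  obtain ⟨σS, frameS, hσS, hfSx, hfSσ, -⟩ := NestedFrames.exists_frame_with_section 2 hS x hx
  -- ### the completed map `ψ : Ŝ → Ŝ′`, local
  have hg : (maximalIdeal S).map ((algebraMap S' (AdicCompletion (maximalIdeal S') S')).comp φ) ≤
      maximalIdeal (AdicCompletion (maximalIdeal S') S') := by
    rw [← Ideal.map_map, hunr, AdicCompletion.maximalIdeal_eq_map]
  obtain ⟨ψ, hψ⟩ := Isol.exists_ringHom_adicCompletion_extend (maximalIdeal S) (maximalIdeal (AdicCompletion (maximalIdeal S') S'))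
    ((algebraMap S' (AdicCompletion (maximalIdeal S') S')).comp φ) hg
  have hψ_of : ∀ s : S, ψ (algebraMap S _ s) = algebraMap S' _ (φ s) := fun s => by
    rw [AdicCompletion.algebraMap_apply, Algebra.algebraMap_self_apply]; exact hψ s
  have hψloc : (maximalIdeal (AdicCompletion (maximalIdeal S) S)).map ψ ≤ maximalIdeal (AdicCompletion (maximalIdeal S') S') := by
    have hcomp : ψ.comp (algebraMap S (AdicCompletion (maximalIdeal S) S)) = (algebraMap S' (AdicCompletion (maximalIdeal S') S')).comp φ :=
      RingHom.ext hψ_of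
    rw [AdicCompletion.maximalIdeal_eq_map, Ideal.map_map, hcomp]
    exact hg
  haveI : IsLocalHom ψ := ((IsLocalRing.local_hom_TFAE ψ).out 0 2).mpr hψloc
  -- ### the completed r.s.o.p.'s
  have hxT : Ideal.span (Set.range fun i => algebraMap S (AdicCompletion (maximalIdeal S) S) (x i)) =
      maximalIdeal (AdicCompletion (maximalIdeal S) S) := by
    have h : Ideal.span (Set.range fun i => algebraMap S (AdicCompletion (maximalIdeal S) S) (x i)) =
        (Ideal.span (Set.range x)).map (algebraMap S (AdicCompletion (maximalIdeal S) S)) := by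
      rw [Ideal.map_span, ← Set.range_comp]; rfl
    rw [h, hx, ← AdicCompletion.maximalIdeal_eq_map]
  have hyT' : Ideal.span (Set.range fun i => algebraMap S' (AdicCompletion (maximalIdeal S') S') ((φ ∘ x) i)) =
      maximalIdeal (AdicCompletion (maximalIdeal S') S') := by
    have h : Ideal.span (Set.range fun i => algebraMap S' (AdicCompletion (maximalIdeal S') S') ((φ ∘ x) i)) =
        (Ideal.span (Set.range (φ ∘ x))).map (algebraMap S' (AdicCompletion (maximalIdeal S') S')) := by
      rw [Ideal.map_span, ← Set.range_comp]; rfl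
    rw [h, hy, ← AdicCompletion.maximalIdeal_eq_map]
  have hrel : ∀ i, ψ (algebraMap S (AdicCompletion (maximalIdeal S) S) (x i)) =
      algebraMap S' (AdicCompletion (maximalIdeal S') S') ((φ ∘ x) i) := fun i => hψ_of (x i)
  have hnT' : (maximalIdeal (AdicCompletion (maximalIdeal S') S')).spanFinrank = (maximalIdeal S).spanFinrank := by
    rw [AdicCompletion.spanFinrank_maximalIdeal_eq]
    have h := IsRegularLocalRing.spanFinrank_maximalIdeal (R := S')
    rw [hS'] at h
    exact_mod_cast h
  -- ### the residue fields: `κ(Ŝ′)/κ(Ŝ)` is finite separable (transport along `κ(S) ≃ κ(Ŝ)`, `κ(S′) ≃ κ(Ŝ′)`)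
  letI algφ : Algebra (ResidueField S) (ResidueField S') := (ResidueField.map φ).toAlgebra
  letI algψ : Algebra (ResidueField (AdicCompletion (maximalIdeal S) S)) (ResidueField (AdicCompletion (maximalIdeal S') S')) :=
    (ResidueField.map ψ).toAlgebra
  haveI := hfin
  haveI := hsep
  let e : ResidueField S ≃+* ResidueField (AdicCompletion (maximalIdeal S) S) :=
    RingEquiv.ofBijective _ (AdicCompletion.residueField_map_bijective S)
  let e' : ResidueField S' ≃+* ResidueField (AdicCompletion (maximalIdeal S') S') :=
    RingEquiv.ofBijective _ (AdicCompletion.residueField_map_bijective S')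
  have he : (algebraMap (ResidueField (AdicCompletion (maximalIdeal S) S)) (ResidueField (AdicCompletion (maximalIdeal S') S'))).comp
        (e : ResidueField S →+* ResidueField (AdicCompletion (maximalIdeal S) S)) =
      (e' : ResidueField S' →+* ResidueField (AdicCompletion (maximalIdeal S') S')).comp (algebraMap (ResidueField S) (ResidueField S')) := by
    refine RingHom.ext fun c => ?_
    obtain ⟨s, rfl⟩ := residue_surjective c
    change ResidueField.map ψ (ResidueField.map (algebraMap S (AdicCompletion (maximalIdeal S) S)) (residue S s)) =
      ResidueField.map (algebraMap S' (AdicCompletion (maximalIdeal S') S')) (ResidueField.map φ (residue S s))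
    rw [ResidueField.map_residue, ResidueField.map_residue, ResidueField.map_residue, ResidueField.map_residue, hψ_of]
  haveI hfinT : Module.Finite (ResidueField (AdicCompletion (maximalIdeal S) S)) (ResidueField (AdicCompletion (maximalIdeal S') S')) :=
    Module.Finite.of_equiv_equiv e e' he
  haveI hsepT : Algebra.IsSeparable (ResidueField (AdicCompletion (maximalIdeal S) S)) (ResidueField (AdicCompletion (maximalIdeal S') S')) :=
    Algebra.IsSeparable.of_equiv_equiv e e' he
  -- ### STEP 1: the nested frame of `Ŝ′`
  obtain ⟨frameT, σT, -, -, -, -, hsq⟩ := NestedFrames.exists_nested_frame_of_separable ψ hnT' _ hxT _ hyT' hrel σS hσS frameS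
    hfSx hfSσ hsepT
  -- ### a basis of `κ(Ŝ′)` over `κ(Ŝ)`, and the dual frame with its extensions
  let b := Module.finBasis (ResidueField (AdicCompletion (maximalIdeal S) S)) (ResidueField (AdicCompletion (maximalIdeal S') S'))
  obtain ⟨r, γ, D, hB, hdual⟩ := hfr
  have hgen : pAdjoin 2 (Set.range γ) = ⊤ := TwoBasis.pAdjoin_eq_top_of_isTwoBasis γ hB
  have hD' : ∀ l, ∃ D' : Derivation ℤ (ResidueField (AdicCompletion (maximalIdeal S') S')) (ResidueField (AdicCompletion (maximalIdeal S') S')),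
      ∀ a, D' (algebraMap _ _ a) = algebraMap _ _ (D l a) := fun l =>
    exists_derivation_extends_of_isSeparable (D l)
  choose D' hD' using hD'
  -- ### the frames comparison
  have key := length_quotient_span_derivation_le_of_frames 2 ψ b frameS frameT (fun t => hsq t) γ D hdual hgen D' hD'
    (algebraMap S (AdicCompletion (maximalIdeal S) S) f)
  rw [hψ_of] at key
  exact key

end Summit.ResolutionOfSingularities.ResolutionOfSingularities.Theorems.SwitchingDichotomy.JacobianLength

end
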